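import Literature.MathematicalPhysics.QuantumLattice.LayeredHeisenbergNeelOrderParameterCeiling
import Literature.MathematicalPhysics.QuantumLattice.AnisotropicXYUnconditionalLongRangeOrder
import Literature.MathematicalPhysics.QuantumLattice.LatticeToriLROProofs
import Mathlib.NumberTheory.Harmonic.Bounds
import HarnessLib

/-!
# The layered quantum XY model (hard-core bosons on weakly coupled planes): Mermin–Wagner + Koma–Tasaki give a CEILING on
# Kennedy–Lieb–Shastry's thermal planar order parameter `liminf |Λ|⁻² Σ_{x,y}⟨S¹_xS¹_y + S²_xS²_y⟩_β ≤ 2βS⁴(16ΣK_∥/H_R + 8|K_⊥|R²)`,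
# hence `≤ 320βS⁴/log(1/r)` for `K = (1,1,r)` — two-sided with the tree's reflection-positivity FLOOR for `S = ½`

Topic `Literature/MathematicalPhysics/QuantumLattice` (family `hubbard`; the XY twin of `LayeredHeisenbergNeelOrderParameterCeiling`,
sequel of `LayeredXYMerminWagnerCeiling` (the Mermin–Wagner ceiling on the SOURCED planar magnetisation of
`xyAnisoTorus L n K = −Σ_xΣ_i K_i(S¹_xS¹_{x+e_i} + S²_xS²_{x+e_i})`, uniformly in the volume), of `XXZThermalSpontaneousOrder`
(the planar XXZ model on the torus as a Koma–Tasaki `ℤ₂` system `XXZKT.z2System` with order `Sʸ_tot`, uniform coupling) and of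
`KomaTasakiGriffithsTheoremSubsequence` §4 (the `U(1)` factor `√2` without hypothesis i)); the floor it is compared with is the
tree's `xyLayered_thermalOrderParameter_ge_spinHalf` (`AnisotropicXYUnconditionalLongRangeOrder`, reflection positivity: planar
long-range order `≥ 1/8 − 869√2/10⁴` for `S = ½`, `K = (1,1,r)`, `0 < r ≤ 2`, `β ≥ β₀(r)`)).

THE QUESTION. As for the antiferromagnet: Koma–Tasaki [cite: KomaTasaki1993, Theorem 2.1 with the Remark after Theorem 6.1
(`SO(2) = U(1)`: factor `√2`)] turn zero-field planar long-range order `σ²` into a sourced magnetisation `≥ √2σ`, which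
Mermin–Wagner (`sq_re_gibbsState_planarSpin_le_layered`) caps; so the ZERO-FIELD thermal order parameter of the tree's floors,
`|Λ|⁻² Σ_{x,y}(Re⟨S¹_xS¹_y⟩ + Re⟨S²_xS²_y⟩)_{β,Λ}` (`xyAnisoThermalCorr`, [KLS1988PRL] Theorem), is bounded ABOVE by the
Mermin–Wagner cost `βS²·2S²(16ΣK_∥/H_R + 8|K_⊥|R²)`, and for `K = (1,1,r)`, `0 < r < 1`, by `320βS⁴/log(1/r)`. For `S = ½`
(hard-core bosons, [MatsubaraMatsuda1956]) the two sides read: `1/8 − 869√2/10⁴ ≤ liminf ≤ 20β/log(1/r)` for `β ≥ β₀(r)`, so the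
tree's ordering inverse temperature satisfies `β₀(r) ≥ (1/8 − 869√2/10⁴) log(1/r)/20` — the condensation temperature of
hard-core bosons on weakly coupled planes is `O(1/log(1/r))` (and positive for every `r > 0` by the floor).

## Contents (everything PROVED, standard axioms; three plumbing definitions, no named fact)

* §X1 **`XXZKT.anisoXYZ2System d L n K`** — `H_K` on `(ℤ/Lℤ)^d` as a Koma–Tasaki `ℤ₂` system: local Hamiltonians
  `XXZKT.xyAnisoLocalHam` (`h_x = −Σ_i K_i (S¹S¹ + S²S²)_{x,x+e_i}`, `Σ_x h_x = xyAnisoTorus L n K` for `L ≥ 3`), `‖h_x‖ ≤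
  (Σ|K_i|)·2s²` (`XXZKT.xyAnisoHbar`), locality off `XXZKT.anisoNbhd`, invariance under the half turn (`halfTurn_conj_sum_xyAnisoLocalHam`),
  `U(1)` invariance (`commute_xyBond_totalSpin_two`, `commute_sum_xyAnisoLocalHam_totalSpin_two`); order `o_x = Sʸ_x`.
  Dictionary `anisoXYZ2System_hamiltonian(_eq_sum)`, `_order` (`= Sʸ_tot`), `_magnetisation`, `_moment_one`
  (`= |Λ|⁻² Σ_{x,y} gibbsSpinCorr β H_K 1 x y`); `XXZKT.inv_card_mul_re_totalSpin_le_sqrt`.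
* §X2 **`XXZKT.anisoXY_thermal_magnetisation_ge_of_eventually_sq_le`** — KT93 Theorem 2.1 with the `U(1)` factor `√2` for
  `H_K` (every `d ≥ 1`, `K`, `β > 0`; generator `Sᶻ_tot`, second component `Sˣ_tot`; hypothesis i) removed): eventual
  `σ² ≤ |Λ|⁻²ΣRe⟨Sʸ_xSʸ_y⟩` forces `√2σ − ε ≤ |Λ|⁻¹Re⟨Sʸ_tot⟩_{β,H_K−B·Sʸ_tot}` eventually, every `B, ε > 0`.
* §X3 **THE CEILINGS** (`m ∈ {1,2}`, every spin `S = n/2`, `β > 0`, `R ≥ 1`): `layeredXY_thermalOrderParameter_liminf_le`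
  (torus form, `(ℤ/(2k+2)ℤ)^{m+1}`), `layeredXY_thermalOrderParameter_box_liminf_le` (the tree's box form: `xyAnisoThermalCorr`
  pulled back to `halfOpenBox (m+1) (2k)`, via `sum_torusPullback_succ` and `Filter.liminf_nat_add`),
  `xyLayered_thermalOrderParameter_liminf_le` (`K = layeredCoupling 1 r`: `≤ 2βS⁴(32/H_R + 8|r|R²)`),
  `xyLayered_thermalOrderParameter_liminf_le_log` (`0 < r < 1`: `≤ 320βS⁴/log(1/r)`), and the two-sided
  `xyLayered_thermalOrderParameter_two_sided_spinHalf` (`∃ β₀ ≥ (1/8 − 869√2/10⁴)log(1/r)/20`, `∀ β ≥ β₀`: floor AND ceiling).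

WHAT THIS IS NOT: constants are Mermin–Wagner-lossy; no statement about a single layer's Kosterlitz–Thouless phase (`K_⊥ = 0`:
the ceiling only says the LRO parameter vanishes); nothing about `T = 0`; nothing about the Hubbard model beyond the hard-core
boson dictionary `S = ½`.

## Mathlib / tree search

REUSED: `KomaTasaki.Z2System.{hamiltonian, order, magnetisation, moment, moment_nonneg,
le_sqrt_two_mul_magnetisation_add_of_eventually_moment_one_u1}` (`KomaTasakiGriffithsTheorem(Subsequence)`); `XXZKT.{sNorm,
one_le_sNorm, norm_spinBond_le, norm_siteSpin_le_sNorm, halfTurn, halfTurn_mul_conjTranspose, halfTurn_conj_totalSpin_one,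
totalSpin_two_comm_totalSpin_zero, totalSpin_two_comm_totalSpin_one, norm_totalSpin_le, norm_comm_totalSpin_zero_one_le,
tendsto_card_torusSite_two_mul_add_two, log_card_config_le}` (`XXZThermalSpontaneousOrder`, `XXZAntiferromagnet…`);
`XXZKT.{anisoNbhd, card_anisoNbhd_le, halfTurn_conj_siteSpin_mul_siteSpin}` (`LayeredHeisenbergNeelOrderParameterCeiling`);
`xyBond`, `spinBond_isHermitian`, `siteSpin_mul_totalSpin`, `commute_spinDot_totalSpin`, `siteSpin_commute_of_ne_holds`;
`xyAnisoTorus_eq_sum` (`AnisotropicXYGaussianDomination`); `gibbsSpinCorr`, `gibbsState_aniso_corr_one_eq_zero`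
(`AnisotropicXYThermalInfraredBound`); `xyAnisoThermalCorr(_of_neZero)`, `xyLayered_thermalOrderParameter_ge_spinHalf`,
`AnisotropicRotator.layeredCoupling` (`AnisotropicXY{SumRuleEnergyBounds,UnconditionalLongRangeOrder}`); `sum_torusPullback_succ`
(`LatticeToriLROProofs`); `sq_re_gibbsState_planarSpin_le_layered` (`LayeredXYMerminWagnerCeiling`); Mathlib
`Filter.liminf_nat_add`, `Filter.eventually_lt_of_lt_liminf`, `Real.abs_le_sqrt`, `log_add_one_le_harmonic`.
`lean search 'anisoXYZ2System|thermalOrderParameter_liminf_le|OrderParameter.*ceiling'` (2026-08-29): nothing; the tree's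
`xyAniso_*`/`xyLayered_*` are floors, its planar KT system `XXZKT.z2System` has uniform coupling.

## References

* N. D. Mermin, H. Wagner, Phys. Rev. Lett. 17 (1966) 1133–1136. [cite: MerminWagnerPRL1966, pp. 1133–1135]
* T. Koma, H. Tasaki, Commun. Math. Phys. 158 (1993) 191–214, Thm. 2.1, Cor. 2.2, Remark after Thm. 6.1.
  [cite: KomaTasaki1993, Theorem 2.1, Remark after Theorem 6.1]
* T. Kennedy, E. H. Lieb, B. S. Shastry, Phys. Rev. Lett. 61 (1988) 2582–2584, eq. (1) and Theorem; J. Stat. Phys. 53 (1988)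
  1019, eq. (5). [cite: KLS1988PRL, eq. (1), Theorem] [cite: KLS1988JSP, eq. (5)]
* A. Klein, L. J. Landau, D. S. Shucker, J. Stat. Phys. 26 (1981) 505–512. [cite: KleinLandauShucker1981]
* T. Matsubara, H. Matsuda, Prog. Theor. Phys. 16 (1956) 569–582. [cite: MatsubaraMatsuda1956]
* H. Tasaki, Physics and Mathematics of Quantum Many-Body Systems (2020), §2.2, §2.5. [cite: Tasaki2020, §2.2, §2.5]
-/

noncomputable section

namespace Literature.MathematicalPhysics.QuantumLattice

open Finset _root_.Matrix Complex _root_.Filter Literature.Probability.LatticeModels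
  Literature.MathematicalPhysics.QuantumLattice.SpinOperators
open scoped ComplexOrder MatrixOrder _root_.Topology _root_.Matrix.Norms.L2Operator

/-! ### §X0 Scalar and counting facts -/

section XYScalarAux

/-- `log(R+1) ≤ Σ_{k<R} 1/(k+1)` (Mathlib's `log_add_one_le_harmonic`). [folklore] -/
private theorem log_succ_le_harmonicSum_xy (R : ℕ) : Real.log ((R : ℝ) + 1) ≤ ∑ k ∈ range R, (1 : ℝ) / (k + 1) := by
  have h := log_add_one_le_harmonic R
  have e : ((harmonic R : ℚ) : ℝ) = ∑ k ∈ range R, (1 : ℝ) / (k + 1) := by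
    simp only [harmonic, Rat.cast_sum, Rat.cast_inv, Rat.cast_add, Rat.cast_one, Rat.cast_natCast, Nat.cast_add,
      Nat.cast_one, one_div]
  rw [e] at h
  exact_mod_cast h

/-- `|Λ| = L^d`. [folklore] -/
private theorem card_torusSite_xy (d L : ℕ) [NeZero L] : Fintype.card (TorusSite d L) = L ^ d := by
  rw [Fintype.card_pi, prod_const, ZMod.card, card_univ, Fintype.card_fin]

end XYScalarAux

/-! ### §X1 The XY model with direction-dependent couplings as a Koma–Tasaki `ℤ₂` system with `U(1)` data -/

namespace XXZKT

section XYGraph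

variable {Λ : Type*} [Fintype Λ] [DecidableEq Λ] (n : ℕ)

/-- `‖S¹_xS¹_y + S²_xS²_y‖ ≤ 2s²` (symmetrised XY bond). [cite: KomaTasaki1993, §2 ii)] -/
theorem norm_xyBond_le_sNorm (x y : Λ) : ‖(xyBond n x y : Op Λ (n + 1))‖ ≤ 2 * sNorm n ^ 2 := by
  rw [xyBond]
  refine (norm_add_le _ _).trans ?_
  have h0 := norm_spinBond_le n 0 x y
  have h1 := norm_spinBond_le n 1 x y
  linarith

/-- `Sᶻ_x` commutes with `Sᶻ_tot`. [cite: Tasaki2020, §2.2 eq. (2.2.11)] -/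
private theorem commute_siteSpin_two_totalSpin_two (x : Λ) : Commute (siteSpin n x 2) (totalSpin n 2 : Op Λ (n + 1)) := by
  have h := siteSpin_mul_totalSpin n x 2 2
  rw [Ring.lie_def, sub_self, onSite_zero, add_zero] at h
  exact h

/-- **`U(1)` invariance of the XY bond**: `[S¹_xS¹_y + S²_xS²_y, Sᶻ_tot] = 0` (`= 𝐒_x·𝐒_y − (S³S³)_{sym}`, both
`Sᶻ_tot`-invariant). [cite: Tasaki2020, §2.5 eq. (2.5.2)] [cite: KLS1988PRL, eq. (1)] -/
theorem commute_xyBond_totalSpin_two (x y : Λ) : Commute (xyBond n x y) (totalSpin n 2 : Op Λ (n + 1)) := by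
  have hz := commute_siteSpin_two_totalSpin_two (Λ := Λ) n
  have e : (xyBond n x y : Op Λ (n + 1)) = spinDot n x y - spinBond n 2 x y := by
    rw [xyBond, spinDot, Fin.sum_univ_three]
    abel
  rw [e]
  refine (commute_spinDot_totalSpin n x y 2).sub_left ?_
  rw [spinBond]
  exact (((hz x).mul_left (hz y)).add_left ((hz y).mul_left (hz x))).smul_left _

/-- The magnetisation per site of a state is at most its largest one-point function:
`|Λ|⁻¹ Re ρ(S^α_tot) ≤ √M` if `(Re ρ(S^α_x))² ≤ M` for all `x`. [cite: KomaTasaki1993, §2 (2.9)] -/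
theorem inv_card_mul_re_totalSpin_le_sqrt (ρ : Op Λ (n + 1) →ₗ[ℂ] ℂ) (α : Fin 3) {M : ℝ}
    (h : ∀ x, (ρ (siteSpin n x α)).re ^ 2 ≤ M) :
    (Fintype.card Λ : ℝ)⁻¹ * (ρ (totalSpin n α)).re ≤ Real.sqrt M := by
  have hx : ∀ x, (ρ (siteSpin n x α)).re ≤ Real.sqrt M := fun x =>
    (le_abs_self _).trans (Real.abs_le_sqrt (h x))
  have hsum : (ρ (totalSpin n α)).re = ∑ x, (ρ (siteSpin n x α)).re := by
    rw [totalSpin, map_sum, Complex.re_sum]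
  rw [hsum]
  have hle : ∑ x, (ρ (siteSpin n x α)).re ≤ (Fintype.card Λ : ℝ) * Real.sqrt M := by
    refine (sum_le_sum fun x _ => hx x).trans ?_
    rw [sum_const, card_univ, nsmul_eq_mul]
  by_cases hc : (Fintype.card Λ : ℝ) = 0
  · rw [hc, _root_.inv_zero, zero_mul]; exact Real.sqrt_nonneg _
  · calc (Fintype.card Λ : ℝ)⁻¹ * ∑ x, (ρ (siteSpin n x α)).re
        ≤ (Fintype.card Λ : ℝ)⁻¹ * ((Fintype.card Λ : ℝ) * Real.sqrt M) :=
          mul_le_mul_of_nonneg_left hle (inv_nonneg.2 (Nat.cast_nonneg _))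
      _ = Real.sqrt M := by rw [← mul_assoc, inv_mul_cancel₀ hc, one_mul]

end XYGraph

section XYTorus

variable (d L n : ℕ) [NeZero L]

/-- **The local Hamiltonian of the XY model with direction-dependent couplings** ([KLS1988JSP] (5), XY version
[KLS1988PRL] (1)): the `d` forward bonds out of `x`, `h_x = −Σ_i K_i (S¹_xS¹_{x+e_i} + S²_xS²_{x+e_i})`, so that
`Σ_x h_x = xyAnisoTorus L n K` on a torus of side `≥ 3`. [cite: KLS1988JSP, eq. (5)] [cite: KLS1988PRL, eq. (1)]
[cite: KomaTasaki1993, §2 (2.2)] -/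
def xyAnisoLocalHam (K : Fin d → ℝ) (x : TorusSite d L) : Op (TorusSite d L) (n + 1) :=
  -∑ i : Fin d, ((K i : ℝ) : ℂ) • xyBond n x (x + Pi.single i 1)

/-- **`Σ_x h_x = xyAnisoTorus L n K`** (`L ≥ 3`). [cite: KLS1988JSP, eq. (5)] [cite: KomaTasaki1993, §2 (2.2)] -/
theorem sum_xyAnisoLocalHam (hL3 : 3 ≤ L) (K : Fin d → ℝ) :
    ∑ x, xyAnisoLocalHam d L n K x = xyAnisoTorus L n K := by
  rw [xyAnisoTorus_eq_sum L n hL3 K]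
  unfold xyAnisoLocalHam
  rw [Finset.sum_neg_distrib]

/-- `h_x` is Hermitian. [cite: KomaTasaki1993, §2 (2.2)] -/
theorem isHermitian_xyAnisoLocalHam (K : Fin d → ℝ) (x : TorusSite d L) : (xyAnisoLocalHam d L n K x).IsHermitian := by
  unfold xyAnisoLocalHam
  refine Matrix.IsHermitian.neg ?_
  refine (isSelfAdjoint_sum univ fun i _ => ?_).isHermitian
  have hb : (xyBond n x (x + Pi.single i 1) : Op (TorusSite d L) (n + 1)).IsHermitian := by
    rw [xyBond]
    exact (spinBond_isHermitian n 0 _ _).add (spinBond_isHermitian n 1 _ _)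
  exact (hb.smul (by rw [isSelfAdjoint_iff, Complex.star_def, Complex.conj_ofReal])).isSelfAdjoint

/-- The uniform bound `h̄_K = (Σ_i |K_i|)·2s²` (KT93 ii)). [cite: KomaTasaki1993, §2 ii)] -/
def xyAnisoHbar (d n : ℕ) (K : Fin d → ℝ) : ℝ := (∑ i, |K i|) * (2 * sNorm n ^ 2)

/-- ii): `‖h_x‖ ≤ h̄_K`. [cite: KomaTasaki1993, §2 ii)] -/
theorem norm_xyAnisoLocalHam_le (K : Fin d → ℝ) (x : TorusSite d L) : ‖xyAnisoLocalHam d L n K x‖ ≤ xyAnisoHbar d n K := by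
  unfold xyAnisoLocalHam xyAnisoHbar
  rw [norm_neg]
  refine (norm_sum_le _ _).trans ?_
  rw [Finset.sum_mul]
  refine sum_le_sum fun i _ => ?_
  rw [norm_smul, Complex.norm_real, Real.norm_eq_abs]
  exact mul_le_mul_of_nonneg_left (norm_xyBond_le_sNorm n x _) (abs_nonneg _)

/-- iii) LOCALITY: `h_x` commutes with every spin component at a site off the forward neighbourhood `S(x)`.
[cite: KomaTasaki1993, §2 iii)] -/
theorem commute_xyAnisoLocalHam_siteSpin (K : Fin d → ℝ) {x y : TorusSite d L} (hy : y ∉ anisoNbhd d L x) (b : Fin 3) :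
    Commute (xyAnisoLocalHam d L n K x) (siteSpin n y b) := by
  have hyx : y ≠ x := fun h => hy (h ▸ mem_insert_self _ _)
  have hyi : ∀ i : Fin d, y ≠ x + Pi.single i 1 := fun i h =>
    hy (mem_insert_of_mem (mem_image.2 ⟨i, mem_univ _, h.symm⟩))
  unfold xyAnisoLocalHam
  refine Commute.neg_left (Commute.sum_left _ _ _ fun i _ => Commute.smul_left ?_ _)
  have hc : ∀ α : Fin 3, Commute (spinBond n α x (x + Pi.single i 1)) (siteSpin n y b : Op (TorusSite d L) (n + 1)) :=
    fun α => by
      rw [spinBond]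
      refine Commute.smul_left (Commute.add_left ?_ ?_) _
      · exact (siteSpin_commute_of_ne_holds n hyx.symm α b).mul_left (siteSpin_commute_of_ne_holds n (hyi i).symm α b)
      · exact (siteSpin_commute_of_ne_holds n (hyi i).symm α b).mul_left (siteSpin_commute_of_ne_holds n hyx.symm α b)
  rw [xyBond]
  exact (hc 0).add_left (hc 1)

/-- (2.3): `U (Σ_x h_x) Uᴴ = Σ_x h_x` — each bond `S¹S¹ + S²S²` is invariant under the half turn about the `3`-axis (two sign
flips; `halfTurn_conj_siteSpin_mul_siteSpin`). [cite: KomaTasaki1993, §2 (2.3)] [cite: Tasaki2020, §2.2 eq. (2.2.12)] -/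
theorem halfTurn_conj_sum_xyAnisoLocalHam (K : Fin d → ℝ) :
    halfTurn n * (∑ x, xyAnisoLocalHam d L n K x) * (halfTurn n)ᴴ = ∑ x, xyAnisoLocalHam d L n K x := by
  simp only [xyAnisoLocalHam, xyBond, spinBond, Finset.mul_sum, Finset.sum_mul, Matrix.mul_neg, Matrix.neg_mul,
    Matrix.mul_smul, Matrix.smul_mul, Matrix.mul_add, Matrix.add_mul, halfTurn_conj_siteSpin_mul_siteSpin]

/-- `U(1)`: `[Σ_x h_x, Sᶻ_tot] = 0`. [cite: KLS1988PRL, eq. (1)] [cite: Tasaki2020, §2.5] -/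
theorem commute_sum_xyAnisoLocalHam_totalSpin_two (K : Fin d → ℝ) :
    Commute (∑ x, xyAnisoLocalHam d L n K x) (totalSpin n 2) :=
  Commute.sum_left _ _ _ fun x _ =>
    Commute.neg_left (Commute.sum_left _ _ _ fun _ _ => (commute_xyBond_totalSpin_two n x _).smul_left _)

/-- **THE XY MODEL WITH DIRECTION-DEPENDENT COUPLINGS `H_K = −Σ_xΣ_i K_i(S¹_xS¹_{x+e_i} + S²_xS²_{x+e_i})` ON THE TORUS AS
A KOMA–TASAKI `ℤ₂` SYSTEM** (KT93 §2 (2.1)–(2.5), ii), iii); the spin-`½` case is the hard-core Bose gas on weakly coupled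
planes): `h_x` the forward bonds, `o_x = Sʸ_x` (`O_Λ = Sʸ_tot`, as in the tree's planar `XXZKT.z2System`), `U_Λ` the half
turn about the `3`-axis, `S(x) = {x, x+e_i}`, `h̄ = (Σ|K_i|)·2s²`, `ō = s`, `r = 2d+2`.
[cite: KomaTasaki1993, §2 (2.1)–(2.9), ii), iii)] [cite: KLS1988JSP, eq. (5)] [cite: KLS1988PRL, eq. (1)] -/
def anisoXYZ2System (K : Fin d → ℝ) :
    KomaTasaki.Z2System (Fintype.card (TorusSite d L)) (xyAnisoHbar d n K) (sNorm n) (2 * d + 2)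
      (TorusSite d L → Fin (n + 1)) where
  h i := xyAnisoLocalHam d L n K ((Fintype.equivFin (TorusSite d L)).symm i)
  o i := siteSpin n ((Fintype.equivFin (TorusSite d L)).symm i) 1
  U := halfTurn n
  supp i := (anisoNbhd d L ((Fintype.equivFin (TorusSite d L)).symm i)).map (Fintype.equivFin (TorusSite d L)).toEmbedding
  isHermitian_h i := isHermitian_xyAnisoLocalHam d L n K _
  isHermitian_o i := siteSpin_isHermitian n _ 1
  U_mul_conjTranspose := halfTurn_mul_conjTranspose n
  conj_hamiltonian := by
    rw [(Fintype.equivFin (TorusSite d L)).symm.sum_comp (fun y => xyAnisoLocalHam d L n K y)]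
    exact halfTurn_conj_sum_xyAnisoLocalHam d L n K
  conj_order := by
    rw [(Fintype.equivFin (TorusSite d L)).symm.sum_comp (fun y => (siteSpin n y 1 : Op (TorusSite d L) (n + 1)))]
    exact halfTurn_conj_totalSpin_one n
  norm_h_le i := norm_xyAnisoLocalHam_le d L n K _
  norm_o_le i := norm_siteSpin_le_sNorm n _ 1
  commute_h_o i j hj := by
    have hj' : (Fintype.equivFin (TorusSite d L)).symm j ∉ anisoNbhd d L ((Fintype.equivFin (TorusSite d L)).symm i) := by
      rwa [Finset.mem_map_equiv] at hj
    exact commute_xyAnisoLocalHam_siteSpin d L n K hj' 1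
  card_supp_le i := by
    rw [Finset.card_map]
    exact (card_anisoNbhd_le d L _).trans (by omega)
  two_le_r := by omega

/-! #### Dictionary -/

/-- `H_Λ = Σ_x h_x` re-indexed by sites. [cite: KomaTasaki1993, §2 (2.2)] -/
theorem anisoXYZ2System_hamiltonian_eq_sum (K : Fin d → ℝ) :
    (anisoXYZ2System d L n K).hamiltonian = ∑ x, xyAnisoLocalHam d L n K x := by
  rw [KomaTasaki.Z2System.hamiltonian]
  change ∑ i, xyAnisoLocalHam d L n K ((Fintype.equivFin (TorusSite d L)).symm i) = _
  rw [(Fintype.equivFin (TorusSite d L)).symm.sum_comp (fun y => xyAnisoLocalHam d L n K y)]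

/-- `H_Λ = xyAnisoTorus L n K` (`L ≥ 3`). [cite: KomaTasaki1993, §2 (2.2)] [cite: KLS1988JSP, eq. (5)] -/
theorem anisoXYZ2System_hamiltonian (hL3 : 3 ≤ L) (K : Fin d → ℝ) :
    (anisoXYZ2System d L n K).hamiltonian = xyAnisoTorus L n K := by
  rw [anisoXYZ2System_hamiltonian_eq_sum, sum_xyAnisoLocalHam d L n hL3]

/-- `O_Λ = Sʸ_tot`. [cite: KomaTasaki1993, §2 (2.4)] -/
theorem anisoXYZ2System_order (K : Fin d → ℝ) :
    (anisoXYZ2System d L n K).order = (totalSpin n 1 : Op (TorusSite d L) (n + 1)) := by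
  rw [KomaTasaki.Z2System.order]
  change ∑ i, (siteSpin n ((Fintype.equivFin (TorusSite d L)).symm i) 1 : Op (TorusSite d L) (n + 1)) = _
  rw [(Fintype.equivFin (TorusSite d L)).symm.sum_comp (fun y => (siteSpin n y 1 : Op (TorusSite d L) (n + 1))),
    totalSpin]

/-- `m_Λ(B) = |Λ|⁻¹ Re⟨Sʸ_tot⟩_{β, H_K − B·Sʸ_tot}` (`L ≥ 3`). [cite: KomaTasaki1993, §2 (2.9)] -/
theorem anisoXYZ2System_magnetisation (hL3 : 3 ≤ L) (K : Fin d → ℝ) (β B : ℝ) :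
    (anisoXYZ2System d L n K).magnetisation β B =
      (Fintype.card (TorusSite d L) : ℝ)⁻¹ *
        (gibbsState β (xyAnisoTorus L n K - (B : ℂ) • totalSpin n 1) (totalSpin n 1)).re := by
  rw [KomaTasaki.Z2System.magnetisation, KomaTasaki.Z2System.fieldHamiltonian, anisoXYZ2System_hamiltonian d L n hL3,
    anisoXYZ2System_order]

/-- **`N⁻²⟨O_Λ²⟩_Λ(0) = |Λ|⁻² Σ_{x,y} Re⟨Sʸ_xSʸ_y⟩_{β,H_K}`** (`L ≥ 3`). [cite: KomaTasaki1993, §2 (2.12)] -/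
theorem anisoXYZ2System_moment_one (hL3 : 3 ≤ L) (K : Fin d → ℝ) (β : ℝ) :
    (anisoXYZ2System d L n K).moment β 1 =
      (∑ x : TorusSite d L, ∑ y : TorusSite d L, gibbsSpinCorr β (xyAnisoTorus L n K) 1 x y) /
        (Fintype.card (TorusSite d L) : ℝ) ^ 2 := by
  rw [KomaTasaki.Z2System.moment, anisoXYZ2System_hamiltonian d L n hL3, anisoXYZ2System_order, mul_one, div_eq_inv_mul]
  congr 1
  rw [pow_two, totalSpin, Finset.sum_mul_sum, map_sum, Complex.re_sum]
  refine Finset.sum_congr rfl fun x _ => ?_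
  rw [map_sum, Complex.re_sum]
  rfl

end XYTorus

/-! ### §X2 Koma–Tasaki's `U(1)` floor for the XY model with direction-dependent couplings (every `d ≥ 1`, every `K`) -/

section XYThermal

variable {d : ℕ}

/-- **KT93 Theorem 2.1 with the `U(1)` factor `√2` FOR `H_K` (every `d ≥ 1`, every `K`, every `β > 0`, hypothesis i)
removed):** an eventual floor `σ² ≤ |Λ|⁻² Σ_{x,y} Re⟨Sʸ_xSʸ_y⟩_{β,H_K}` (`σ ≥ 0`) along the even tori `(ℤ/(2k+2)ℤ)^d` forces, for
every field `B > 0` and `ε > 0`, eventually `√2 σ − ε ≤ |Λ|⁻¹ Re⟨Sʸ_tot⟩_{β, H_K − B·Sʸ_tot}` (generator `Sᶻ_tot`, second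
component `Sˣ_tot`; the tree's `Z2System.le_sqrt_two_mul_magnetisation_add_of_eventually_moment_one_u1`).
[cite: KomaTasaki1993, Theorem 2.1 (2.13), Corollary 2.2 with Remark after Theorem 6.1] [cite: KLS1988PRL, eq. (1)] -/
theorem anisoXY_thermal_magnetisation_ge_of_eventually_sq_le (hd : 1 ≤ d) {n : ℕ} (K : Fin d → ℝ) {β : ℝ}
    (hβ : 0 < β) {σ : ℝ} (hσ : 0 ≤ σ)
    (hLRO : ∀ᶠ k : ℕ in atTop, σ ^ 2 ≤
      (∑ x : TorusSite d (2 * k + 2), ∑ y : TorusSite d (2 * k + 2),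
          gibbsSpinCorr β (xyAnisoTorus (2 * k + 2) n K) 1 x y) / ((2 * k + 2 : ℕ) : ℝ) ^ (2 * d))
    {B : ℝ} (hB : 0 < B) {ε : ℝ} (hε : 0 < ε) :
    ∀ᶠ k : ℕ in atTop, Real.sqrt 2 * σ - ε ≤ (Fintype.card (TorusSite d (2 * k + 2)) : ℝ)⁻¹ *
      (gibbsState β (xyAnisoTorus (2 * k + 2) n K - (B : ℂ) • totalSpin n 1) (totalSpin n 1)).re := by
  have hLRO' : ∀ᶠ k : ℕ in atTop, σ ^ 2 ≤ (anisoXYZ2System d (2 * k + 2) n K).moment β 1 := by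
    filter_upwards [hLRO, eventually_ge_atTop 1] with k hk hk1
    rw [anisoXYZ2System_moment_one d (2 * k + 2) n (by omega) K β, card_torusSite_xy, Nat.cast_pow, ← pow_mul,
      mul_comm d 2]
    exact hk
  have hev := KomaTasaki.Z2System.le_sqrt_two_mul_magnetisation_add_of_eventually_moment_one_u1
    (fun k => anisoXYZ2System d (2 * k + 2) n K) (fun k => (totalSpin n 0 : Op (TorusSite d (2 * k + 2)) (n + 1)))
    (fun k => (totalSpin n 2 : Op (TorusSite d (2 * k + 2)) (n + 1))) Complex.I_ne_zero zero_le_one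
    (fun k => totalSpin_isHermitian n 0)
    (fun k => by
      rw [anisoXYZ2System_hamiltonian_eq_sum]
      exact commute_sum_xyAnisoLocalHam_totalSpin_two d _ n K)
    (fun k => by
      rw [anisoXYZ2System_order]
      exact totalSpin_two_comm_totalSpin_zero n)
    (fun k => by
      rw [anisoXYZ2System_order]
      exact totalSpin_two_comm_totalSpin_one n)
    (fun k => norm_totalSpin_le n 0)
    (fun k => by
      rw [anisoXYZ2System_order]
      exact norm_comm_totalSpin_zero_one_le n)
    (zero_le_one.trans (one_le_sNorm n)) hβ (tendsto_card_torusSite_two_mul_add_two hd)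
    (fun k => log_card_config_le d (2 * k + 2) n) hσ hLRO' hB hε
  filter_upwards [hev, eventually_ge_atTop 1] with k hk hk1
  rw [anisoXYZ2System_magnetisation d (2 * k + 2) n (by omega)] at hk
  linarith

end XYThermal

end XXZKT

/-! ### §X3 THE CEILING ON THE THERMAL PLANAR ORDER PARAMETER OF THE LAYERED XY MODEL -/

section XYCeiling

variable {m : ℕ}

/-- **MERMIN–WAGNER + KOMA–TASAKI: A CEILING ON THE THERMAL PLANAR ORDER PARAMETER OF WEAKLY COUPLED XY LAYERS, IN THE
SYMMETRIC (ZERO-FIELD) GIBBS STATES.** On the even tori `(ℤ/(2k+2)ℤ)^{m+1}`, `m ∈ {1,2}`, for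
`H_K = −Σ_xΣ_i K_i(S¹_xS¹_{x+e_i} + S²_xS²_{x+e_i})` (in-plane `K_j`, `j < m`; interlayer `K_m`), every spin, `β > 0`, `R ≥ 1`:
`liminf_k |Λ|⁻² Σ_{x,y}(Re⟨S¹_xS¹_y⟩ + Re⟨S²_xS²_y⟩)_{β,H_K} ≤ β S²·2S²(16(Σ_{j<m}|K_j|)/H_R + 8|K_m|R²)` — the planar
long-range order parameter (the quantity the tree's reflection-positivity FLOORS `xyAniso_thermalOrderParameter_ge*`,
`xyLayered_thermalOrderParameter_ge_spinHalf` bound from below) is bounded ABOVE by the Mermin–Wagner cost. Proof: an eventual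
floor `2σ²` on the functional is a floor `σ²` on the `Sʸ` moment (`gibbsState_aniso_corr_one_eq_zero`); Koma–Tasaki `U(1)`
(generator `Sᶻ_tot`, hypothesis i) removed) give `√2σ − ε ≤ m_Λ(B)` eventually; Mermin–Wagner
(`sq_re_gibbsState_planarSpin_le_layered`, uniformly in `Λ`) gives `m_Λ(B) ≤ √(c + c'B)`; `B, ε → 0`: `2σ² ≤ c`.
[cite: MerminWagnerPRL1966, pp. 1133–1135] [cite: KomaTasaki1993, Theorem 2.1, Remark after Theorem 6.1]
[cite: KleinLandauShucker1981] [cite: KLS1988PRL, eq. (1) and Theorem] -/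
theorem layeredXY_thermalOrderParameter_liminf_le (hm1 : 1 ≤ m) (hm2 : m ≤ 2) (K : Fin (m + 1) → ℝ) (n : ℕ)
    {β : ℝ} (hβ : 0 < β) {R : ℕ} (hR : 1 ≤ R) :
    liminf (fun k : ℕ =>
      (∑ x : TorusSite (m + 1) (2 * k + 2), ∑ y : TorusSite (m + 1) (2 * k + 2),
          (gibbsSpinCorr β (xyAnisoTorus (2 * k + 2) n K) 0 x y + gibbsSpinCorr β (xyAnisoTorus (2 * k + 2) n K) 1 x y)) /
        ((2 * k + 2 : ℕ) : ℝ) ^ (2 * (m + 1))) atTop ≤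
      β * ((n : ℝ) / 2) ^ 2 * (2 * ((n : ℝ) / 2) ^ 2 *
        (16 * (∑ j : Fin m, |K (Fin.castSucc j)|) / (∑ k ∈ range R, (1 : ℝ) / (k + 1)) +
          8 * |K (Fin.last m)| * (R : ℝ) ^ 2)) := by
  set c : ℝ := β * ((n : ℝ) / 2) ^ 2 * (2 * ((n : ℝ) / 2) ^ 2 *
    (16 * (∑ j : Fin m, |K (Fin.castSucc j)|) / (∑ k ∈ range R, (1 : ℝ) / (k + 1)) +
      8 * |K (Fin.last m)| * (R : ℝ) ^ 2)) with hc
  set c' : ℝ := β * ((n : ℝ) / 2) ^ 2 * ((n : ℝ) / 2 * (4 * (R : ℝ) ^ 2)) with hc'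
  set G : ℕ → ℝ := fun k =>
    (∑ x : TorusSite (m + 1) (2 * k + 2), ∑ y : TorusSite (m + 1) (2 * k + 2),
        gibbsSpinCorr β (xyAnisoTorus (2 * k + 2) n K) 1 x y) / ((2 * k + 2 : ℕ) : ℝ) ^ (2 * (m + 1)) with hG
  set F : ℕ → ℝ := fun k =>
    (∑ x : TorusSite (m + 1) (2 * k + 2), ∑ y : TorusSite (m + 1) (2 * k + 2),
        (gibbsSpinCorr β (xyAnisoTorus (2 * k + 2) n K) 0 x y + gibbsSpinCorr β (xyAnisoTorus (2 * k + 2) n K) 1 x y)) /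
      ((2 * k + 2 : ℕ) : ℝ) ^ (2 * (m + 1)) with hF
  have HRpos : 0 < ∑ k ∈ range R, (1 : ℝ) / (k + 1) := lt_of_lt_of_le one_pos (one_le_sum_range_one_div_succ hR)
  have hc0 : 0 ≤ c := by positivity
  have hc'0 : 0 ≤ c' := by positivity
  -- `U(1)` symmetry: the functional is twice the `Sʸ` moment
  have hFG : ∀ k, F k = 2 * G k := fun k => by
    simp only [hF, hG]
    rw [mul_div_assoc']
    congr 1
    rw [Finset.mul_sum]
    refine sum_congr rfl fun x _ => ?_
    rw [Finset.mul_sum]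
    refine sum_congr rfl fun y _ => ?_
    have h01 : gibbsSpinCorr β (xyAnisoTorus (2 * k + 2) n K) 0 x y = gibbsSpinCorr β (xyAnisoTorus (2 * k + 2) n K) 1 x y := by
      rw [gibbsSpinCorr, gibbsSpinCorr, gibbsState_aniso_corr_one_eq_zero]
    rw [h01]
    ring
  have hG0 : ∀ k, 1 ≤ k → 0 ≤ G k := fun k hk => by
    have h := KomaTasaki.Z2System.moment_nonneg (XXZKT.anisoXYZ2System (m + 1) (2 * k + 2) n K) β 1
    rw [XXZKT.anisoXYZ2System_moment_one (m + 1) (2 * k + 2) n (by omega) K β, card_torusSite_xy, Nat.cast_pow,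
      ← pow_mul, mul_comm (m + 1) 2] at h
    simpa only [hG] using h
  by_contra hcon
  rw [not_le] at hcon
  have hbdd : IsBoundedUnder (· ≥ ·) atTop F := by
    refine ⟨0, ?_⟩
    rw [eventually_map]
    filter_upwards [eventually_ge_atTop 1] with k hk
    show 0 ≤ F k
    rw [hFG]
    exact mul_nonneg (by norm_num) (hG0 k hk)
  set ℓ := liminf F atTop with hℓ
  have hev : ∀ᶠ k in atTop, (c + ℓ) / 2 < F k := eventually_lt_of_lt_liminf (by linarith) hbdd
  set σ : ℝ := Real.sqrt ((c + ℓ) / 2 / 2) with hσ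
  have hσ0 : 0 ≤ σ := Real.sqrt_nonneg _
  have hσ2 : σ ^ 2 = (c + ℓ) / 2 / 2 := Real.sq_sqrt (by linarith)
  have hLRO : ∀ᶠ k : ℕ in atTop, σ ^ 2 ≤ G k := by
    filter_upwards [hev] with k hk
    rw [hFG] at hk
    rw [hσ2]
    linarith
  have hkey : ∀ B : ℝ, 0 < B → ∀ ε : ℝ, 0 < ε → Real.sqrt 2 * σ - ε ≤ Real.sqrt (c + c' * B) := by
    intro B hB ε hε
    have hKT := XXZKT.anisoXY_thermal_magnetisation_ge_of_eventually_sq_le (d := m + 1) (by omega) K hβ hσ0 hLRO hB hε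
    obtain ⟨k, hk, hk1⟩ := (hKT.and (eventually_ge_atTop 1)).exists
    refine hk.trans (XXZKT.inv_card_mul_re_totalSpin_le_sqrt n _ 1 fun x => ?_)
    have hmw := sq_re_gibbsState_planarSpin_le_layered (2 * k + 2) n hm1 hm2 (by omega) K
      (α := 1) (by decide) B hβ.le hR x
    rw [abs_of_pos hB] at hmw
    refine le_trans (le_of_eq ?_) (hmw.trans (le_of_eq ?_))
    · rfl
    · rw [hc, hc']
      ring
  have h2 : 2 * σ ^ 2 ≤ c := by
    refine le_of_forall_pos_le_add fun ε hε => ?_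
    have hB : 0 < ε / (c' + 1) := div_pos hε (by linarith)
    have h1 : Real.sqrt 2 * σ ≤ Real.sqrt (c + c' * (ε / (c' + 1))) :=
      le_of_forall_pos_le_add fun ε' hε' => by linarith [hkey _ hB ε' hε']
    have h2 : (Real.sqrt 2 * σ) ^ 2 ≤ (Real.sqrt (c + c' * (ε / (c' + 1)))) ^ 2 :=
      pow_le_pow_left₀ (mul_nonneg (Real.sqrt_nonneg _) hσ0) h1 2
    rw [mul_pow, Real.sq_sqrt (by norm_num : (0 : ℝ) ≤ 2),
      Real.sq_sqrt (add_nonneg hc0 (mul_nonneg hc'0 hB.le))] at h2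
    have h4 : c' * (ε / (c' + 1)) ≤ ε := by
      rw [mul_div_assoc', div_le_iff₀ (by linarith : (0 : ℝ) < c' + 1)]
      nlinarith
    linarith
  rw [hσ2] at h2
  linarith

/-- **The box form, matching the tree's floors** (`xyAnisoThermalCorr`, pulled back to the fundamental domains
`halfOpenBox (m+1) (2k)` as in `xyAniso_thermalOrderParameter_ge`): for `m ∈ {1,2}`, every spin, `β > 0`, `R ≥ 1`,
`liminf_k |Λ_{2k}|⁻² Σ_{x,y ∈ [0,2k)^{m+1}} (Re⟨S¹S¹⟩ + Re⟨S²S²⟩)_{β,H_K,Λ_{2k}} ≤ β S²·2S²(16ΣK_∥/H_R + 8|K_⊥|R²)`.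
[cite: MerminWagnerPRL1966, pp. 1133–1135] [cite: KomaTasaki1993, Theorem 2.1] [cite: KLS1988PRL, Theorem] -/
theorem layeredXY_thermalOrderParameter_box_liminf_le (hm1 : 1 ≤ m) (hm2 : m ≤ 2) (K : Fin (m + 1) → ℝ) (n : ℕ)
    {β : ℝ} (hβ : 0 < β) {R : ℕ} (hR : 1 ≤ R) :
    liminf (fun k : ℕ => (∑ x ∈ halfOpenBox (m + 1) (2 * k), ∑ y ∈ halfOpenBox (m + 1) (2 * k),
        torusPullback (fun L x y => xyAnisoThermalCorr β K L n x y) (2 * k) x y) /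
          ((halfOpenBox (m + 1) (2 * k)).card : ℝ) ^ 2) atTop ≤
      β * ((n : ℝ) / 2) ^ 2 * (2 * ((n : ℝ) / 2) ^ 2 *
        (16 * (∑ j : Fin m, |K (Fin.castSucc j)|) / (∑ k ∈ range R, (1 : ℝ) / (k + 1)) +
          8 * |K (Fin.last m)| * (R : ℝ) ^ 2)) := by
  set f : ℕ → ℝ := fun k => (∑ x ∈ halfOpenBox (m + 1) (2 * k), ∑ y ∈ halfOpenBox (m + 1) (2 * k),
    torusPullback (fun L x y => xyAnisoThermalCorr β K L n x y) (2 * k) x y) /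
      ((halfOpenBox (m + 1) (2 * k)).card : ℝ) ^ 2 with hf
  have hpt : ∀ k : ℕ, f (k + 1) =
      (∑ x : TorusSite (m + 1) (2 * k + 2), ∑ y : TorusSite (m + 1) (2 * k + 2),
          (gibbsSpinCorr β (xyAnisoTorus (2 * k + 2) n K) 0 x y + gibbsSpinCorr β (xyAnisoTorus (2 * k + 2) n K) 1 x y)) /
        ((2 * k + 2 : ℕ) : ℝ) ^ (2 * (m + 1)) := by
    intro k
    simp only [hf]
    rw [show 2 * (k + 1) = 2 * k + 1 + 1 by ring, sum_torusPullback_succ]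
    show (∑ x : TorusSite (m + 1) (2 * k + 2), ∑ y : TorusSite (m + 1) (2 * k + 2),
        xyAnisoThermalCorr β K (2 * k + 2) n x y) / ((2 * k + 2 : ℕ) : ℝ) ^ (2 * (m + 1)) = _
    simp only [xyAnisoThermalCorr_of_neZero]
  rw [← Filter.liminf_nat_add f 1]
  simp only [hpt]
  exact layeredXY_thermalOrderParameter_liminf_le hm1 hm2 K n hβ hR

/-- **KENNEDY–LIEB–SHASTRY'S LAYERED XY MODEL / HARD-CORE BOSONS ON WEAKLY COUPLED PLANES, `K = (1, 1, r)`**: for every spin,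
every `r`, `β > 0`, `R ≥ 1`, the thermal planar order parameter along the boxes `[0,2k)³` obeys
`liminf ≤ 2βS⁴(32/H_R + 8|r|R²)`. [cite: MerminWagnerPRL1966, pp. 1133–1135] [cite: KomaTasaki1993, Theorem 2.1]
[cite: KLS1988PRL, Theorem] [cite: KLS1988JSP, eq. (5)] -/
theorem xyLayered_thermalOrderParameter_liminf_le (r : ℝ) (n : ℕ) {β : ℝ} (hβ : 0 < β) {R : ℕ} (hR : 1 ≤ R) :
    liminf (fun k : ℕ => (∑ x ∈ halfOpenBox 3 (2 * k), ∑ y ∈ halfOpenBox 3 (2 * k),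
        torusPullback (fun L x y => xyAnisoThermalCorr β (AnisotropicRotator.layeredCoupling 1 r) L n x y) (2 * k) x y) /
          ((halfOpenBox 3 (2 * k)).card : ℝ) ^ 2) atTop ≤
      2 * β * ((n : ℝ) / 2) ^ 4 * (32 / (∑ k ∈ range R, (1 : ℝ) / (k + 1)) + 8 * |r| * (R : ℝ) ^ 2) := by
  have h := layeredXY_thermalOrderParameter_box_liminf_le (m := 2) (by norm_num) le_rfl
    (AnisotropicRotator.layeredCoupling 1 r) n hβ hR
  have e0 : AnisotropicRotator.layeredCoupling 1 r (Fin.castSucc (0 : Fin 2)) = 1 := by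
    simp [AnisotropicRotator.layeredCoupling]
  have e1 : AnisotropicRotator.layeredCoupling 1 r (Fin.castSucc (1 : Fin 2)) = 1 := by
    simp [AnisotropicRotator.layeredCoupling]
  have e2 : AnisotropicRotator.layeredCoupling 1 r (Fin.last 2) = r := by
    simp [AnisotropicRotator.layeredCoupling]
  rw [Fin.sum_univ_two, e0, e1, e2, abs_one] at h
  refine h.trans (le_of_eq ?_)
  ring

/-- **THE `1/log(1/r)` CEILING FOR THE LAYERED XY MODEL** (`0 < r < 1`, every spin, every `β > 0`): the thermal planar order
parameter along the boxes obeys `liminf ≤ 320βS⁴/log(1/r)` (scale `R = ⌊(1/r)^{1/4}⌋`). [cite: MerminWagnerPRL1966, pp. 1133–1135]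
[cite: KomaTasaki1993, Theorem 2.1] [cite: KleinLandauShucker1981] [cite: KLS1988PRL, Theorem] -/
theorem xyLayered_thermalOrderParameter_liminf_le_log {r : ℝ} (hr0 : 0 < r) (hr1 : r < 1) (n : ℕ) {β : ℝ}
    (hβ : 0 < β) :
    liminf (fun k : ℕ => (∑ x ∈ halfOpenBox 3 (2 * k), ∑ y ∈ halfOpenBox 3 (2 * k),
        torusPullback (fun L x y => xyAnisoThermalCorr β (AnisotropicRotator.layeredCoupling 1 r) L n x y) (2 * k) x y) /
          ((halfOpenBox 3 (2 * k)).card : ℝ) ^ 2) atTop ≤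
      320 * β * ((n : ℝ) / 2) ^ 4 / Real.log (1 / r) := by
  set t : ℝ := Real.sqrt (Real.sqrt (1 / r)) with ht
  have hr1' : 1 < 1 / r := by rw [lt_div_iff₀ hr0]; linarith
  have ht1 : 1 ≤ t := Real.one_le_sqrt.2 (Real.one_le_sqrt.2 hr1'.le)
  have ht0 : 0 < t := one_pos.trans_le ht1
  have ht4 : t ^ 4 = 1 / r := by
    rw [show t ^ 4 = (t ^ 2) ^ 2 by ring, ht, Real.sq_sqrt (Real.sqrt_nonneg _), Real.sq_sqrt (by positivity)]
  set R : ℕ := ⌊t⌋₊ with hRdef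
  have hR1 : 1 ≤ R := Nat.floor_pos.2 ht1
  have hRt : (R : ℝ) ≤ t := Nat.floor_le ht0.le
  have htR : t < (R : ℝ) + 1 := Nat.lt_floor_add_one t
  have hR0 : (0 : ℝ) < R := by exact_mod_cast hR1
  have hrR4 : r * (R : ℝ) ^ 4 ≤ 1 := by
    have h1 : (R : ℝ) ^ 4 ≤ t ^ 4 := pow_le_pow_left₀ hR0.le hRt 4
    rw [ht4] at h1
    calc r * (R : ℝ) ^ 4 ≤ r * (1 / r) := mul_le_mul_of_nonneg_left h1 hr0.le
      _ = 1 := by field_simp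
  set H : ℝ := ∑ k ∈ range R, (1 : ℝ) / (k + 1) with hH
  have hH1 : 1 ≤ H := one_le_sum_range_one_div_succ hR1
  have hH0 : 0 < H := by linarith
  have hHR : H ≤ (R : ℝ) := by
    have h1 : ∀ k ∈ range R, (1 : ℝ) / (k + 1) ≤ 1 := fun k _ => by
      rw [div_le_one (by positivity)]
      have := (Nat.cast_nonneg k : (0 : ℝ) ≤ k)
      linarith
    calc H ≤ ∑ _k ∈ range R, (1 : ℝ) := sum_le_sum h1
      _ = R := by rw [sum_const, card_range, nsmul_eq_mul, mul_one]
  have hrR2 : r * (R : ℝ) ^ 2 ≤ 1 / H := by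
    rw [le_div_iff₀ hH0]
    calc r * (R : ℝ) ^ 2 * H ≤ r * (R : ℝ) ^ 2 * (R : ℝ) ^ 2 := by
          refine mul_le_mul_of_nonneg_left (hHR.trans ?_) (by positivity)
          nlinarith
      _ = r * (R : ℝ) ^ 4 := by ring
      _ ≤ 1 := hrR4
  have hlog : Real.log (1 / r) / 4 ≤ H := by
    have h1 : Real.log t = Real.log (1 / r) / 4 := by
      rw [ht, Real.log_sqrt (Real.sqrt_nonneg _), Real.log_sqrt (by positivity)]
      ring
    have h2 : Real.log t ≤ Real.log ((R : ℝ) + 1) := Real.log_le_log ht0 htR.le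
    linarith [log_succ_le_harmonicSum_xy R]
  have hlog0 : 0 < Real.log (1 / r) := Real.log_pos hr1'
  have hmain := xyLayered_thermalOrderParameter_liminf_le r n hβ hR1
  rw [abs_of_pos hr0] at hmain
  refine hmain.trans ?_
  have hS : 0 ≤ 2 * β * ((n : ℝ) / 2) ^ 4 := by positivity
  calc 2 * β * ((n : ℝ) / 2) ^ 4 * (32 / H + 8 * r * (R : ℝ) ^ 2)
      ≤ 2 * β * ((n : ℝ) / 2) ^ 4 * (40 / H) := by
        refine mul_le_mul_of_nonneg_left ?_ hS
        have : 8 * r * (R : ℝ) ^ 2 ≤ 8 * (1 / H) := by linarith [hrR2]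
        rw [show (40 : ℝ) / H = 32 / H + 8 * (1 / H) by ring]
        linarith
    _ = 80 * β * ((n : ℝ) / 2) ^ 4 / H := by ring
    _ ≤ 80 * β * ((n : ℝ) / 2) ^ 4 / (Real.log (1 / r) / 4) :=
        div_le_div_of_nonneg_left (by positivity) (by positivity) hlog
    _ = 320 * β * ((n : ℝ) / 2) ^ 4 / Real.log (1 / r) := by
        field_simp
        ring

/-- **HARD-CORE BOSONS ON WEAKLY COUPLED PLANES, TWO-SIDED** (spin `½`, `K = (1, 1, r)`, `0 < r < 1`): the tree's
reflection-positivity FLOOR (`xyLayered_thermalOrderParameter_ge_spinHalf`: there is `β₀(r) > 0` with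
`1/8 − 869√2/10⁴ ≤ liminf` for all `β ≥ β₀`) and this file's Mermin–Wagner–Koma–Tasaki CEILING `liminf ≤ 20β/log(1/r)`
(`320·(½)⁴ = 20`) for the SAME thermal planar order parameter: `∃ β₀ > 0, ∀ β ≥ β₀,
1/8 − 869√2/10⁴ ≤ liminf ≤ 20β/log(1/r)` — in particular the ordering inverse temperature `β₀(r)` of the floor is at least
`(1/8 − 869√2/10⁴)·log(1/r)/20`: the condensation temperature of hard-core bosons on weakly coupled planes is
`O(1/log(1/r))`. [cite: KLS1988PRL, Theorem] [cite: MerminWagnerPRL1966, pp. 1133–1135] [cite: KomaTasaki1993, Theorem 2.1]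
[cite: MatsubaraMatsuda1956] -/
theorem xyLayered_thermalOrderParameter_two_sided_spinHalf {r : ℝ} (hr0 : 0 < r) (hr1 : r < 1) :
    ∃ β₀ : ℝ, 0 < β₀ ∧ (1 / 8 - 869 * Real.sqrt 2 / 10000) * Real.log (1 / r) / 20 ≤ β₀ ∧ ∀ β : ℝ, β₀ ≤ β →
      1 / 8 - 869 * Real.sqrt 2 / 10000 ≤
          liminf (fun k : ℕ => (∑ x ∈ halfOpenBox 3 (2 * k), ∑ y ∈ halfOpenBox 3 (2 * k),
            torusPullback (fun L x y => xyAnisoThermalCorr β (AnisotropicRotator.layeredCoupling 1 r) L 1 x y) (2 * k)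
              x y) / ((halfOpenBox 3 (2 * k)).card : ℝ) ^ 2) atTop ∧
        liminf (fun k : ℕ => (∑ x ∈ halfOpenBox 3 (2 * k), ∑ y ∈ halfOpenBox 3 (2 * k),
            torusPullback (fun L x y => xyAnisoThermalCorr β (AnisotropicRotator.layeredCoupling 1 r) L 1 x y) (2 * k)
              x y) / ((halfOpenBox 3 (2 * k)).card : ℝ) ^ 2) atTop ≤ 20 * β / Real.log (1 / r) := by
  obtain ⟨β₀, hβ₀, hfloor⟩ := xyLayered_thermalOrderParameter_ge_spinHalf hr0 (by linarith)
  have hlog0 : 0 < Real.log (1 / r) := Real.log_pos (by rw [lt_div_iff₀ hr0]; linarith)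
  have hceil : ∀ β : ℝ, 0 < β →
      liminf (fun k : ℕ => (∑ x ∈ halfOpenBox 3 (2 * k), ∑ y ∈ halfOpenBox 3 (2 * k),
          torusPullback (fun L x y => xyAnisoThermalCorr β (AnisotropicRotator.layeredCoupling 1 r) L 1 x y) (2 * k)
            x y) / ((halfOpenBox 3 (2 * k)).card : ℝ) ^ 2) atTop ≤ 20 * β / Real.log (1 / r) := by
    intro β hβ
    have h := xyLayered_thermalOrderParameter_liminf_le_log hr0 hr1 1 hβ
    refine h.trans (le_of_eq ?_)
    rw [Nat.cast_one]
    ring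
  -- the floor at `β₀` and the ceiling at `β₀` give the lower bound on `β₀`
  have hβ₀ge : (1 / 8 - 869 * Real.sqrt 2 / 10000) * Real.log (1 / r) / 20 ≤ β₀ := by
    have h1 := (hfloor β₀ le_rfl).trans (hceil β₀ hβ₀)
    have h2 : (1 / 8 - 869 * Real.sqrt 2 / 10000) * Real.log (1 / r) ≤ 20 * β₀ := (le_div_iff₀ hlog0).1 h1
    rw [div_le_iff₀ (by norm_num : (0 : ℝ) < 20)]
    linarith
  exact ⟨β₀, hβ₀, hβ₀ge, fun β hβ => ⟨hfloor β hβ, hceil β (hβ₀.trans_le hβ)⟩⟩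

end XYCeiling

end Literature.MathematicalPhysics.QuantumLattice

end
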